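import Literature.NumberTheory.Sieve.HeathBrownCubicLemma92Lattice
import Literature.NumberTheory.Sieve.HeathBrownCubicTypeIIWeightBounds
import HarnessLib

/-!
# The per-generator integrals `𝓙_v = χ(β_v) I(β_v){1 + O(Δ)}` and `𝓙 = I·∑_{β̂ ∈ 𝒞} d_{(β)}χ(β) + O(…)` ((9.21)–(9.22))

Part of the reduction *Lemma 9.2 ⇐ Lemma 9.4* in §9 of D. R. Heath-Brown, *Primes represented by `x³ + 2y³`*,
Acta Math. 186 (2001) (this seat's route to the named fact `HeathBrown2001_lemma_3_8`). Pages 59–60: "if `β̂ ∈ 𝒞`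
and `W((β); Δ, 𝐱) ≠ 0`, then `|𝐱' − β̂| ≪ ΔV^{1/3}` … In general we will have `𝐱 ∈ 𝒞` unless `β̂` is within a
distance `O(ΔV^{1/3})` of the edge of `𝒞`. For such `β` … `∫_{𝐱 ∈ 𝒞} W((β); Δ, 𝐱) = I(β)`, say. It follows that
`𝓙 = ∑_{β∈𝒞} d_{(β)}χ(β){1 + O(Δ)}I(β) + O(∑*_β d_{(β)} I(β))` (9.21) … `I(β)` is in fact independent of `β`
… `d_S ≪ 1` (9.22) … the number of such `β` is `O(ΔV)`. We therefore deduce that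
`𝓙 = I{∑_{β∈𝒞} d_{(β)}χ(β) + O(ΔV)}`." This file PROVES the corresponding explicit statement for the objects of
`HeathBrownCubicLemma92Lattice` (`Jv`, with the branch relation `Near` in place of `𝓕`, `I(β) = γ₀Δ³V` from
`integral_orbitIntegrand`, `d_S ≤ 8` from `dWeight_le_eight`):

* `IvC` (`I(v; 𝒞) = ∫_𝒞 𝟙_{D(v̂)}W(v̂; Δ, ·)`), `IvC_nonneg`, `IvC_le` (`≤ γ₀Δ³V`);
* `phaseFn_mul_nu0O` (`e^{itv⁻¹log β(𝐱)}ν₀(β) = χ(β)e^{itσ}`), `norm_Jv_integrand_sub_le`, **`norm_Jv_sub_le`**: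
  `|𝓙_v − χ(β_v)I(v; 𝒞)| ≤ 2πΔ·I(v; 𝒞)` (`|σ| < Δ` on the support, `|t| ≤ π`);
* `norm_sub_le_of_orbitIntegrand_ne_zero`, `IvC_eq_of_interior` (`= γ₀Δ³V`), `IvC_eq_zero_of_exterior` (Lemma 9.5 as
  `Lemma95Bound C₀`, radius `C₀(1 + 2/c₄)Δ‖v̂‖`), `mem_realCube_of_mem_inner`, `not_mem_realCube_of_not_mem_outer`,
  `latticeCube_eq_filter`;
* `Tchi` (`T(χ) = ∑_{β̂∈𝒞} d_{(β)}χ(β)`) and **`norm_sum_Jv_sub_le`**: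
  `|∑_v d_{(β_v)}𝓙_v − γ₀Δ³V·T(χ)| ≤ γ₀Δ³V·(16πΔ·#𝒞'_ℤ + 8·#{v ∈ outer cube : v̂ ∉ inner cube})` with the cubes thickened
  / shrunk by `ρ = C₀(1 + 2/c₄)ΔR`, `R ≥ ‖v̂‖` on the enlarged cube.

## References

* D. R. Heath-Brown, *Primes represented by `x³ + 2y³`*, Acta Math. 186 (2001), §9 pp. 57–60, (9.21)–(9.22).
  [cite: HeathBrownActa2001, §9 (9.21)–(9.22)]

## Mathlib / tree search

Tree: `Jv`, `phaseFn`, `Lemma95Bound`, `mem_realCube_thicken`, `ell_pos_of_normForm_pos`, `integrableOn_Jv_integrand`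
(`HeathBrownCubicLemma92Lattice`), `integral_orbitIntegrand`, `integrable_orbitIntegrand`, `orbitIntegrand_nonneg` (`HeathBrownCubicEmbeddingVolume`),
`abs_unitCoord_lt`, `unitCoord` (`HeathBrownCubicLemma95`), `nu0O`, `charAngle`, `abs_charAngle_le`, `norm_mulChar_apply_units` (`HeathBrownCubicGrossen`),
`dWeight_le_eight`, `dWeight_nonneg` (`HeathBrownCubicTypeIIWeightBounds`), `gamma₀_pos` (`HeathBrownCubicSiegelWalfisz`).
Mathlib: `setIntegral_le_integral`, `setIntegral_eq_integral_of_forall_compl_eq_zero`, `setIntegral_eq_zero_of_forall_eq_zero`,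
`Complex.norm_exp_sub_one_le`, `norm_integral_le_of_norm_le`, `integral_complex_ofReal`.
-/

noncomputable section

open Polynomial NumberField Finset Complex MeasureTheory

namespace Literature.NumberTheory.Sieve.CubicSieve

open LFunctions.CubeRootTwoField CubicPrimes Literature.Analysis.Fourier

variable {q : ℕ} (χ : MulChar (QuotMod q) ℂ)

/-! ### `I(v; 𝒞) = ∫_𝒞 𝟙_{D(v̂)} W(v̂; Δ, ·)` -/

/-- **`I(v; 𝒞)`**, the part over the cube `𝒞` of the orbit integral `I(β_v)` of p. 59. [cite: HeathBrownActa2001, §9 p. 59] -/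
def IvC (Δ V : ℝ) (a : ℝ × ℝ × ℝ) (S₀ : ℝ) (v : ℤ × ℤ × ℤ) : ℝ :=
  ∫ x in realCube a S₀, orbitIntegrand Δ V (castVec v) x

variable {Δ V : ℝ} {a : ℝ × ℝ × ℝ} {S₀ : ℝ}

/-- `0 ≤ I(v; 𝒞)`. [folklore] -/
theorem IvC_nonneg (Δ V : ℝ) (a : ℝ × ℝ × ℝ) (S₀ : ℝ) (v : ℤ × ℤ × ℤ) : 0 ≤ IvC Δ V a S₀ v :=
  setIntegral_nonneg (measurableSet_realCube a S₀) fun _ _ => orbitIntegrand_nonneg _ _ _ _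

/-- **`I(v; 𝒞) ≤ I(β_v) = γ₀Δ³V`** (`0 < Δ ≤ 1/2`, `V > 0`, `β(v̂) > 0`, `N(v̂) > ΔV`). [cite: HeathBrownActa2001, §9 p. 60] -/
theorem IvC_le (hΔ : 0 < Δ) (hΔ2 : Δ ≤ 1 / 2) (hV : 0 < V) {v : ℤ × ℤ × ℤ}
    (hv : 0 < ell (castVec v) ∧ Δ * V < normForm (castVec v)) (a : ℝ × ℝ × ℝ) (S₀ : ℝ) :
    IvC Δ V a S₀ v ≤ gamma₀ * Δ ^ 3 * V := by
  rw [IvC, ← integral_orbitIntegrand hΔ hΔ2 hV hv.1 hv.2]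
  exact setIntegral_le_integral (integrable_orbitIntegrand hΔ hV hv.1 hv.2)
    (Filter.Eventually.of_forall fun x => orbitIntegrand_nonneg _ _ _ _)

/-! ### `𝓙_v = χ(β_v) I(v; 𝒞) {1 + O(Δ)}` -/

/-- **`e^{itv⁻¹log β(𝐱)} ν₀(β) = χ(β) e^{itσ(β̂, 𝐱)}`** for `β(β̂) > 0` ("we will have
`ν₀(β) = (1 + O(Δ)) χ(β) exp(−itv⁻¹ log β(𝐱))`", p. 57). [cite: HeathBrownActa2001, §9 p. 57] -/
theorem phaseFn_mul_nu0O (v : ℤ × ℤ × ℤ) (hv : 0 < ell (castVec v)) (x : ℝ × ℝ × ℝ) :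
    phaseFn χ x * nu0O χ (coordElt v) =
      χ (toQuotMod q (coordElt v)) * Complex.exp ((charAngle χ * unitCoord (castVec v) x : ℝ) * Complex.I) := by
  have hell : ellO (coordElt v) = ell (castVec v) := by rw [← ell_realVec, realVec_coordElt]
  rw [phaseFn, nu0O, hell, abs_of_pos hv, div_self hv.ne', Complex.ofReal_one, one_pow, mul_one, unitCoord]
  calc Complex.exp (((charAngle χ * (Real.log (ell x) / unitLog) : ℝ)) * Complex.I) *
        (χ (toQuotMod q (coordElt v)) * Complex.exp (((-(charAngle χ * (Real.log (ell (castVec v)) / unitLog)) : ℝ)) * Complex.I))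
      = χ (toQuotMod q (coordElt v)) * (Complex.exp (((charAngle χ * (Real.log (ell x) / unitLog) : ℝ)) * Complex.I) *
          Complex.exp (((-(charAngle χ * (Real.log (ell (castVec v)) / unitLog)) : ℝ)) * Complex.I)) := by ring
    _ = χ (toQuotMod q (coordElt v)) * Complex.exp ((charAngle χ * ((Real.log (ell x) - Real.log (ell (castVec v))) / unitLog) : ℝ) * Complex.I) := by
        rw [← Complex.exp_add]; congr 2; push_cast; ring

/-- **Pointwise**: `|e^{itv⁻¹log β(𝐱)}ν₀(β_v)·𝟙_D W − χ(β_v)·𝟙_D W| ≤ 2πΔ·𝟙_D W` (on the support `|σ| < Δ`,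
`|e^{itσ} − 1| ≤ 2|t|Δ ≤ 2πΔ`; `0 < Δ ≤ 1/4`). [cite: HeathBrownActa2001, §9 p. 57] -/
theorem norm_Jv_integrand_sub_le (hq : 1 ≤ q) (hΔ : 0 < Δ) (hΔ4 : Δ ≤ 1 / 4) {v : ℤ × ℤ × ℤ} (hv : 0 < ell (castVec v))
    (x : ℝ × ℝ × ℝ) :
    ‖phaseFn χ x * nu0O χ (coordElt v) * (orbitIntegrand Δ V (castVec v) x : ℂ) -
        χ (toQuotMod q (coordElt v)) * (orbitIntegrand Δ V (castVec v) x : ℂ)‖ ≤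
      2 * Real.pi * Δ * orbitIntegrand Δ V (castVec v) x := by
  have horb0 := orbitIntegrand_nonneg Δ V (castVec v) x
  by_cases h0 : orbitIntegrand Δ V (castVec v) x = 0
  · rw [h0]; simp
  · -- on the support
    have hmem : x ∈ orbitSet Δ V (castVec v) := by
      by_contra h; exact h0 (by rw [orbitIntegrand, Set.indicator_of_notMem h])
    obtain ⟨hx, hnear, hwin⟩ := hmem
    have hW : pairWeight Δ (castVec v) x ≠ 0 := by
      intro h; apply h0; rw [orbitIntegrand, Set.indicator_of_mem (show x ∈ orbitSet Δ V (castVec v) from ⟨hx, hnear, hwin⟩), h]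
    have hσ := abs_unitCoord_lt hΔ hΔ4 hv hx hnear hW
    rw [phaseFn_mul_nu0O χ v hv x, ← sub_mul, norm_mul, Complex.norm_real, Real.norm_eq_abs, abs_of_nonneg horb0,
      ← mul_sub_one, norm_mul]
    have hχ : ‖χ (toQuotMod q (coordElt v))‖ ≤ 1 := by
      by_cases hu : IsUnit (toQuotMod q (coordElt v))
      · obtain ⟨w, hw⟩ := hu; rw [← hw]; exact (norm_mulChar_apply_units hq χ w).le
      · rw [MulChar.map_nonunit χ hu, norm_zero]; exact zero_le_one
    have hsmall : ‖((charAngle χ * unitCoord (castVec v) x : ℝ) : ℂ) * Complex.I‖ ≤ 1 := by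
      rw [norm_mul, Complex.norm_I, mul_one, Complex.norm_real, Real.norm_eq_abs, abs_mul]
      have ht := abs_charAngle_le χ
      have := Real.pi_le_four
      nlinarith [abs_nonneg (charAngle χ), abs_nonneg (unitCoord (castVec v) x)]
    have hexp : ‖Complex.exp (((charAngle χ * unitCoord (castVec v) x : ℝ) : ℂ) * Complex.I) - 1‖ ≤ 2 * Real.pi * Δ := by
      refine (Complex.norm_exp_sub_one_le hsmall).trans ?_
      rw [norm_mul, Complex.norm_I, mul_one, Complex.norm_real, Real.norm_eq_abs, abs_mul]
      have ht := abs_charAngle_le χ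
      nlinarith [abs_nonneg (charAngle χ), abs_nonneg (unitCoord (castVec v) x), Real.pi_pos]
    calc ‖χ (toQuotMod q (coordElt v))‖ * ‖Complex.exp (((charAngle χ * unitCoord (castVec v) x : ℝ) : ℂ) * Complex.I) - 1‖ *
          orbitIntegrand Δ V (castVec v) x ≤ 1 * (2 * Real.pi * Δ) * orbitIntegrand Δ V (castVec v) x :=
          mul_le_mul_of_nonneg_right (mul_le_mul hχ hexp (norm_nonneg _) zero_le_one) horb0
      _ = 2 * Real.pi * Δ * orbitIntegrand Δ V (castVec v) x := by ring

/-- **`|𝓙_v − χ(β_v) I(v; 𝒞)| ≤ 2πΔ · I(v; 𝒞)`** ("`ν₀(β) = (1 + O(Δ))χ(β) exp(−itv⁻¹log β(𝐱))`", p. 57, integrated).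
[cite: HeathBrownActa2001, §9 (9.21)] -/
theorem norm_Jv_sub_le (hq : 1 ≤ q) (hΔ : 0 < Δ) (hΔ4 : Δ ≤ 1 / 4) (hV : 0 < V) {v : ℤ × ℤ × ℤ}
    (hv : 0 < ell (castVec v) ∧ Δ * V < normForm (castVec v)) (a : ℝ × ℝ × ℝ) (S₀ : ℝ) :
    ‖Jv χ Δ V a S₀ v - χ (toQuotMod q (coordElt v)) * IvC Δ V a S₀ v‖ ≤ 2 * Real.pi * Δ * IvC Δ V a S₀ v := by
  have hint := (integrable_orbitIntegrand hΔ hV hv.1 hv.2).integrableOn (s := realCube a S₀)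
  have hintC : IntegrableOn (fun x => (orbitIntegrand Δ V (castVec v) x : ℂ)) (realCube a S₀) := hint.ofReal
  have hA : IntegrableOn (fun x => phaseFn χ x * nu0O χ (coordElt v) * (orbitIntegrand Δ V (castVec v) x : ℂ)) (realCube a S₀) := by
    have := integrableOn_Jv_integrand χ hΔ hV hv a S₀ (nu0O χ (coordElt v))
    refine this.congr_fun (fun x _ => by ring) (measurableSet_realCube a S₀)
  have hB : IntegrableOn (fun x => χ (toQuotMod q (coordElt v)) * (orbitIntegrand Δ V (castVec v) x : ℂ)) (realCube a S₀) :=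
    hintC.const_mul _
  have heq : Jv χ Δ V a S₀ v - χ (toQuotMod q (coordElt v)) * IvC Δ V a S₀ v =
      ∫ x in realCube a S₀, (phaseFn χ x * nu0O χ (coordElt v) * (orbitIntegrand Δ V (castVec v) x : ℂ) -
        χ (toQuotMod q (coordElt v)) * (orbitIntegrand Δ V (castVec v) x : ℂ)) := by
    rw [integral_sub hA hB, Jv, IvC, integral_const_mul, integral_complex_ofReal]
  rw [heq]
  refine (norm_integral_le_of_norm_le (hint.const_mul (2 * Real.pi * Δ)) (Filter.Eventually.of_forall fun x =>
    norm_Jv_integrand_sub_le χ hq hΔ hΔ4 hv.1 x)).trans (le_of_eq ?_)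
  rw [integral_const_mul, IvC]

/-! ### Interior and exterior generators -/

/-- **Support of the orbit integrand near the generator** (Lemma 9.5 with `c₄/2`): if `v̂ ∈ 𝒞` (so
`N(v̂) ≥ c₄V`) and `𝟙_{D(v̂)}W(v̂; Δ, 𝐱) ≠ 0` then `‖𝐱 − v̂‖ ≤ C₀(1 + 2/c₄)Δ‖v̂‖`. [cite: HeathBrownActa2001, Lemma 9.5] -/
theorem norm_sub_le_of_orbitIntegrand_ne_zero {C₀ : ℝ} (h95 : Lemma95Bound C₀) {c₄ : ℝ} (hc₄ : 0 < c₄) (hV : 0 < V)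
    (hΔ : 0 < Δ) (hΔ16 : Δ ≤ 1 / 16) (hΔc : Δ ≤ c₄ / 4) {b : ℝ × ℝ × ℝ} (hb : 0 < ell b) (hNb : c₄ * V ≤ normForm b)
    {x : ℝ × ℝ × ℝ} (hx : orbitIntegrand Δ V b x ≠ 0) : ‖x - b‖ ≤ C₀ * (1 + 1 / (c₄ / 2)) * Δ * ‖b‖ := by
  have hmem : x ∈ orbitSet Δ V b := by
    by_contra h; exact hx (by rw [orbitIntegrand, Set.indicator_of_notMem h])
  obtain ⟨hellx, hnear, hwin⟩ := hmem
  have hW : pairWeight Δ b x ≠ 0 := by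
    intro h; apply hx; rw [orbitIntegrand, Set.indicator_of_mem (show x ∈ orbitSet Δ V b from ⟨hellx, hnear, hwin⟩), h]
  have hNx : c₄ / 2 * V ≤ normForm x := by nlinarith [hwin.1]
  exact h95 (c₄ / 2) V Δ b x (by positivity) hV hΔ hΔ16 (by linarith) hb hellx hnear hW hwin hNx

/-- **Interior generators**: if the sup-norm ball of radius `C₀(1 + 2/c₄)Δ‖v̂‖` about `v̂ ∈ 𝒞` lies in `𝒞` then
`I(v; 𝒞) = I(β_v) = γ₀Δ³V` ("if `𝐱 ∈ 𝓕` it follows that `𝐱' = 𝐱`, so that `𝐱 ∈ 𝒞`. For such `β` we may therefore deduce that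
`∫_{𝐱 ∈ 𝒞, …} W = ∫_{𝐱 ∈ 𝓕, …} W = I(β)`", p. 59). [cite: HeathBrownActa2001, §9 p. 59] -/
theorem IvC_eq_of_interior {C₀ : ℝ} (h95 : Lemma95Bound C₀) {c₄ : ℝ} (hc₄ : 0 < c₄) (hV : 0 < V)
    (hΔ : 0 < Δ) (hΔ16 : Δ ≤ 1 / 16) (hΔc : Δ ≤ c₄ / 4) {v : ℤ × ℤ × ℤ} (hv : 0 < ell (castVec v))
    (hNv : c₄ * V ≤ normForm (castVec v))
    (hball : ∀ x : ℝ × ℝ × ℝ, ‖x - castVec v‖ ≤ C₀ * (1 + 1 / (c₄ / 2)) * Δ * ‖castVec v‖ → x ∈ realCube a S₀) :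
    IvC Δ V a S₀ v = gamma₀ * Δ ^ 3 * V := by
  have hΔV : Δ * V < normForm (castVec v) := by nlinarith
  rw [IvC, setIntegral_eq_integral_of_forall_compl_eq_zero, integral_orbitIntegrand hΔ (by linarith) hV hv hΔV]
  intro x hx
  by_contra h
  exact hx (hball x (norm_sub_le_of_orbitIntegrand_ne_zero h95 hc₄ hV hΔ hΔ16 hΔc hv hNv h))

/-- **Exterior generators**: if the ball of radius `C₀(1 + 2/c₄)Δ‖v̂‖` about `v̂` misses `𝒞` (a cube with
`N ≥ c₄V`), then `I(v; 𝒞) = 0`. [cite: HeathBrownActa2001, §9 p. 59] -/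
theorem IvC_eq_zero_of_exterior {C₀ : ℝ} (h95 : Lemma95Bound C₀) (hC₀ : 0 ≤ C₀) {c₃ c₄ : ℝ} (hc₄ : 0 < c₄) (hV : 0 < V)
    (hΔ : 0 < Δ) (hΔ16 : Δ ≤ 1 / 16) (hΔc : Δ ≤ c₄ / 4) (hcube : CubeCond c₃ c₄ V a S₀) {v : ℤ × ℤ × ℤ}
    (hv : 0 < ell (castVec v))
    (hball : ∀ x : ℝ × ℝ × ℝ, ‖x - castVec v‖ ≤ C₀ * (1 + 1 / (c₄ / 2)) * Δ * ‖castVec v‖ → x ∉ realCube a S₀) :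
    IvC Δ V a S₀ v = 0 := by
  rw [IvC]
  refine setIntegral_eq_zero_of_forall_eq_zero fun x hxC => ?_
  by_contra h
  have hmem : x ∈ orbitSet Δ V (castVec v) := by
    by_contra h'; exact h (by rw [orbitIntegrand, Set.indicator_of_notMem h'])
  obtain ⟨hellx, hnear, hwin⟩ := hmem
  have hW : pairWeight Δ (castVec v) x ≠ 0 := by
    intro h'; apply h; rw [orbitIntegrand, Set.indicator_of_mem (show x ∈ orbitSet Δ V (castVec v) from ⟨hellx, hnear, hwin⟩), h']
  have hNx : c₄ * V ≤ normForm x := by have := (hcube x hxC).2.2.2; rw [normForm]; exact this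
  have h1 := h95 c₄ V Δ (castVec v) x hc₄ hV hΔ hΔ16 (by linarith) hv hellx hnear hW hwin hNx
  have h2 : C₀ * (1 + 1 / c₄) * Δ * ‖castVec v‖ ≤ C₀ * (1 + 1 / (c₄ / 2)) * Δ * ‖castVec v‖ := by
    have : 1 / c₄ ≤ 1 / (c₄ / 2) := by rw [div_le_div_iff_of_pos_left one_pos hc₄ (by positivity)]; linarith
    have h0 : 0 ≤ Δ * ‖castVec v‖ := by positivity
    calc C₀ * (1 + 1 / c₄) * Δ * ‖castVec v‖ = C₀ * (1 + 1 / c₄) * (Δ * ‖castVec v‖) := by ring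
      _ ≤ C₀ * (1 + 1 / (c₄ / 2)) * (Δ * ‖castVec v‖) := by gcongr
      _ = _ := by ring
  exact hball x (h1.trans h2) hxC

/-! ### The sum over the generators ((9.21)–(9.22)) -/

/-- **`T(χ) = ∑_{β̂ ∈ 𝒞} d_{(β)} χ(β)`**, the character sum of (9.1) (its `χ = χ₀`, `q`-coprimality-free form is
`cubeClassSum`-like). [cite: HeathBrownActa2001, §9 (9.1)] -/
def Tchi (X τ : ℝ) {n : ℕ} (m : Fin (n + 1) → ℕ) (a : ℝ × ℝ × ℝ) (S₀ : ℝ) : ℂ :=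
  ∑ v ∈ latticeCube a S₀, (dWeight X τ m (Ideal.span {coordElt v}) : ℂ) * χ (toQuotMod q (coordElt v))

/-- Interior test: a point of the shrunken cube `(a + ρ, a + S₀ − ρ]³` has its `ρ`-ball (sup norm) inside `𝒞`. [folklore] -/
theorem mem_realCube_of_mem_inner {ρ : ℝ} {b x : ℝ × ℝ × ℝ}
    (hb : b ∈ realCube (a.1 + ρ, a.2.1 + ρ, a.2.2 + ρ) (S₀ - 2 * ρ)) (hx : ‖x - b‖ ≤ ρ) : x ∈ realCube a S₀ := by
  rw [mem_realCube] at hb ⊢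
  rw [Prod.norm_def, Prod.norm_def, Real.norm_eq_abs, Real.norm_eq_abs, Real.norm_eq_abs] at hx
  simp only [Prod.fst_sub, Prod.snd_sub] at hx
  have h1 := (le_max_left _ _).trans hx
  have h2 := ((le_max_left _ _).trans (le_max_right _ _)).trans hx
  have h3 := ((le_max_right _ _).trans (le_max_right _ _)).trans hx
  rw [abs_le] at h1 h2 h3
  obtain ⟨⟨a1, b1⟩, ⟨a2, b2⟩, ⟨a3, b3⟩⟩ := hb
  exact ⟨⟨by linarith, by linarith⟩, ⟨by linarith, by linarith⟩, ⟨by linarith, by linarith⟩⟩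

/-- Exterior test: a point outside the enlarged cube `(a − ρ, a + S₀ + ρ]³` has its `ρ`-ball outside `𝒞`. [folklore] -/
theorem not_mem_realCube_of_not_mem_outer {ρ : ℝ} {b x : ℝ × ℝ × ℝ}
    (hb : b ∉ realCube (a.1 - ρ, a.2.1 - ρ, a.2.2 - ρ) (S₀ + 2 * ρ)) (hx : ‖x - b‖ ≤ ρ) : x ∉ realCube a S₀ := by
  intro hxC
  apply hb
  rw [mem_realCube] at hxC ⊢
  rw [Prod.norm_def, Prod.norm_def, Real.norm_eq_abs, Real.norm_eq_abs, Real.norm_eq_abs] at hx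
  simp only [Prod.fst_sub, Prod.snd_sub] at hx
  have h1 := (le_max_left _ _).trans hx
  have h2 := ((le_max_left _ _).trans (le_max_right _ _)).trans hx
  have h3 := ((le_max_right _ _).trans (le_max_right _ _)).trans hx
  rw [abs_le] at h1 h2 h3
  obtain ⟨⟨a1, b1⟩, ⟨a2, b2⟩, ⟨a3, b3⟩⟩ := hxC
  exact ⟨⟨by linarith, by linarith⟩, ⟨by linarith, by linarith⟩, ⟨by linarith, by linarith⟩⟩

open scoped Classical in
/-- The lattice points of `𝒞` are among those of the enlarged cube with `β(v̂) > 0`, `N(v̂) > ΔV`, and are exactly the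
ones with `v̂ ∈ 𝒞`. [folklore] -/
theorem latticeCube_eq_filter {c₃ c₄ : ℝ} (hc₄ : 0 < c₄) (hV : 0 < V) (hΔc : Δ < c₄) (hcube : CubeCond c₃ c₄ V a S₀)
    {r : ℝ} (hr : 0 ≤ r) :
    latticeCube a S₀ = ((latticeCube (a.1 - 2 * r, a.2.1 - 2 * r, a.2.2 - 2 * r) (S₀ + 3 * r)).filter
        (fun v => 0 < ell (castVec v) ∧ Δ * V < normForm (castVec v))).filter (fun v => castVec v ∈ realCube a S₀) := by
  ext v
  rw [Finset.mem_filter, Finset.mem_filter, mem_latticeCube_iff, mem_latticeCube_iff]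
  constructor
  · intro hv
    have hN : c₄ * V ≤ normForm (castVec v) := by have := (hcube _ hv).2.2.2; rw [normForm]; exact this
    refine ⟨⟨?_, ell_pos_of_normForm_pos (lt_of_lt_of_le (by positivity) hN), by nlinarith⟩, hv⟩
    have := mem_realCube_thicken hv (b := castVec v) (r := r) (by rw [sub_self, norm_zero]; exact hr)
    exact this
  · exact fun h => h.2

open scoped Classical in
/-- **`𝓙 = I(β)·T(χ) + O(…)`** ((9.21)–(9.22)): "`𝓙 = ∑_{β ∈ 𝒞} d_{(β)} χ(β){1 + O(Δ)} I(β) + O(∑_β^* d_{(β)} I(β))`, where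
`∑^*` counts those `β` for which `|β̂ − 𝐭| ≪ ΔV^{1/3}` for some `𝐭` on the boundary of `𝒞`" and "`d_S ≪ 1`" (9.22), here with
`I(β) = γ₀Δ³V` (`integral_orbitIntegrand`), `d_S ≤ 8` (`dWeight_le_eight`): for `ρ = C₀(1 + 2/c₄)ΔR`, `R ≥ ‖v̂‖` on the
enlarged cube, `|∑_v d_v 𝓙_v − γ₀Δ³V·T(χ)| ≤ γ₀Δ³V (16πΔ·#𝒞'_lattice + 8·#{v ∈ outer cube, v̂ ∉ inner cube})`.
[cite: HeathBrownActa2001, §9 (9.21)–(9.22)] -/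
theorem norm_sum_Jv_sub_le {X τ : ℝ} {n : ℕ} {m : Fin (n + 1) → ℕ} (hq : 1 ≤ q) {C₀ : ℝ} (h95 : Lemma95Bound C₀) (hC₀ : 0 < C₀)
    {c₃ c₄ : ℝ} (hc₄ : 0 < c₄) (hV : 0 < V) (hΔ : 0 < Δ) (hΔ16 : Δ ≤ 1 / 16) (hΔc : Δ ≤ c₄ / 4)
    (hcube : CubeCond c₃ c₄ V a S₀) (hX : 1 < X) (hτ : 0 < τ) (hτ1 : τ ≤ 1) (hm : CoreAdmissible τ m)
    {r : ℝ} (hr : 0 ≤ r) {R : ℝ} (hR0 : 0 ≤ R)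
    (hR : ∀ v ∈ latticeCube (a.1 - 2 * r, a.2.1 - 2 * r, a.2.2 - 2 * r) (S₀ + 3 * r), ‖castVec v‖ ≤ R) :
    ‖∑ v ∈ (latticeCube (a.1 - 2 * r, a.2.1 - 2 * r, a.2.2 - 2 * r) (S₀ + 3 * r)).filter
          (fun v => 0 < ell (castVec v) ∧ Δ * V < normForm (castVec v)),
        (dWeight X τ m (Ideal.span {coordElt v}) : ℂ) * Jv χ Δ V a S₀ v -
        (gamma₀ * Δ ^ 3 * V : ℝ) * Tchi χ X τ m a S₀‖ ≤
      gamma₀ * Δ ^ 3 * V *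
        (16 * Real.pi * Δ * ((latticeCube (a.1 - 2 * r, a.2.1 - 2 * r, a.2.2 - 2 * r) (S₀ + 3 * r)).filter
            (fun v => 0 < ell (castVec v) ∧ Δ * V < normForm (castVec v))).card +
          8 * ((latticeCube (a.1 - C₀ * (1 + 1 / (c₄ / 2)) * Δ * R, a.2.1 - C₀ * (1 + 1 / (c₄ / 2)) * Δ * R,
                a.2.2 - C₀ * (1 + 1 / (c₄ / 2)) * Δ * R) (S₀ + 2 * (C₀ * (1 + 1 / (c₄ / 2)) * Δ * R))).filter
              (fun v => castVec v ∉ realCube (a.1 + C₀ * (1 + 1 / (c₄ / 2)) * Δ * R, a.2.1 + C₀ * (1 + 1 / (c₄ / 2)) * Δ * R,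
                a.2.2 + C₀ * (1 + 1 / (c₄ / 2)) * Δ * R) (S₀ - 2 * (C₀ * (1 + 1 / (c₄ / 2)) * Δ * R)))).card) := by
  classical
  set ρ : ℝ := C₀ * (1 + 1 / (c₄ / 2)) * Δ * R with hρ
  set I₀ : ℝ := gamma₀ * Δ ^ 3 * V with hI₀
  have hI₀0 : 0 ≤ I₀ := by have := gamma₀_pos; positivity
  set L := (latticeCube (a.1 - 2 * r, a.2.1 - 2 * r, a.2.2 - 2 * r) (S₀ + 3 * r)).filter
    (fun v => 0 < ell (castVec v) ∧ Δ * V < normForm (castVec v)) with hL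
  set Bd := (latticeCube (a.1 - ρ, a.2.1 - ρ, a.2.2 - ρ) (S₀ + 2 * ρ)).filter
    (fun v => castVec v ∉ realCube (a.1 + ρ, a.2.1 + ρ, a.2.2 + ρ) (S₀ - 2 * ρ)) with hBd
  have hΔ4 : Δ ≤ 1 / 4 := by linarith
  have hΔ2 : Δ ≤ 1 / 2 := by linarith
  have hd0 : ∀ v, 0 ≤ dWeight X τ m (Ideal.span {coordElt v}) := fun v => dWeight_nonneg hX hτ hτ1 hm _
  have hd8 : ∀ v, dWeight X τ m (Ideal.span {coordElt v}) ≤ 8 := fun v => dWeight_le_eight hX hτ hτ1 hm _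
  have hχ : ∀ v : ℤ × ℤ × ℤ, ‖χ (toQuotMod q (coordElt v))‖ ≤ 1 := by
    intro v
    by_cases hu : IsUnit (toQuotMod q (coordElt v))
    · obtain ⟨w, hw⟩ := hu; rw [← hw]; exact (norm_mulChar_apply_units hq χ w).le
    · rw [MulChar.map_nonunit χ hu, norm_zero]; exact zero_le_one
  -- Step i: replace `𝓙_v` by `χ(β_v) I(v; 𝒞)`
  have h1 : ‖∑ v ∈ L, (dWeight X τ m (Ideal.span {coordElt v}) : ℂ) * Jv χ Δ V a S₀ v -
      ∑ v ∈ L, (dWeight X τ m (Ideal.span {coordElt v}) : ℂ) * (χ (toQuotMod q (coordElt v)) * IvC Δ V a S₀ v)‖ ≤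
      I₀ * (16 * Real.pi * Δ * L.card) := by
    rw [← Finset.sum_sub_distrib]
    have hterm : ∀ v ∈ L, ‖(dWeight X τ m (Ideal.span {coordElt v}) : ℂ) * Jv χ Δ V a S₀ v -
        (dWeight X τ m (Ideal.span {coordElt v}) : ℂ) * (χ (toQuotMod q (coordElt v)) * IvC Δ V a S₀ v)‖ ≤ 16 * Real.pi * Δ * I₀ := by
      intro v hv
      have hv' := (Finset.mem_filter.mp hv).2
      rw [← mul_sub, norm_mul, Complex.norm_real, Real.norm_eq_abs, abs_of_nonneg (hd0 v)]
      have hb := norm_Jv_sub_le χ hq hΔ hΔ4 hV hv' a S₀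
      have hIv := IvC_le hΔ hΔ2 hV hv' a S₀
      calc dWeight X τ m (Ideal.span {coordElt v}) * ‖Jv χ Δ V a S₀ v - χ (toQuotMod q (coordElt v)) * IvC Δ V a S₀ v‖
          ≤ 8 * (2 * Real.pi * Δ * I₀) := by
            refine mul_le_mul (hd8 v) (hb.trans ?_) (norm_nonneg _) (by norm_num)
            exact mul_le_mul_of_nonneg_left hIv (by positivity)
        _ = 16 * Real.pi * Δ * I₀ := by ring
    calc ‖∑ v ∈ L, ((dWeight X τ m (Ideal.span {coordElt v}) : ℂ) * Jv χ Δ V a S₀ v -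
          (dWeight X τ m (Ideal.span {coordElt v}) : ℂ) * (χ (toQuotMod q (coordElt v)) * IvC Δ V a S₀ v))‖
        ≤ ∑ v ∈ L, 16 * Real.pi * Δ * I₀ := (norm_sum_le _ _).trans (Finset.sum_le_sum hterm)
      _ = I₀ * (16 * Real.pi * Δ * L.card) := by rw [Finset.sum_const, nsmul_eq_mul]; ring
  -- Step ii: `T(χ)·I₀` as a sum over `L`
  have hT : (I₀ : ℂ) * Tchi χ X τ m a S₀ =
      ∑ v ∈ L, (dWeight X τ m (Ideal.span {coordElt v}) : ℂ) * (χ (toQuotMod q (coordElt v)) *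
        (if castVec v ∈ realCube a S₀ then I₀ else 0 : ℝ)) := by
    have hΔc' : Δ < c₄ := by linarith
    rw [Tchi, latticeCube_eq_filter hc₄ hV hΔc' hcube hr, Finset.sum_filter, Finset.mul_sum]
    refine Finset.sum_congr rfl fun v _ => ?_
    split_ifs <;> push_cast <;> ring
  -- Step iii: interior/exterior vanish, boundary is `≤ 8 I₀`
  have h2 : ‖∑ v ∈ L, (dWeight X τ m (Ideal.span {coordElt v}) : ℂ) * (χ (toQuotMod q (coordElt v)) * IvC Δ V a S₀ v) -
      (I₀ : ℂ) * Tchi χ X τ m a S₀‖ ≤ I₀ * (8 * Bd.card) := by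
    rw [hT, ← Finset.sum_sub_distrib]
    have hterm : ∀ v ∈ L, ‖(dWeight X τ m (Ideal.span {coordElt v}) : ℂ) * (χ (toQuotMod q (coordElt v)) * IvC Δ V a S₀ v) -
        (dWeight X τ m (Ideal.span {coordElt v}) : ℂ) * (χ (toQuotMod q (coordElt v)) * (if castVec v ∈ realCube a S₀ then I₀ else 0 : ℝ))‖ ≤
        if v ∈ Bd then 8 * I₀ else 0 := by
      intro v hv
      have hvL := Finset.mem_filter.mp hv
      have hv' := hvL.2
      have hRv : ‖castVec v‖ ≤ R := hR v hvL.1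
      have hρv : C₀ * (1 + 1 / (c₄ / 2)) * Δ * ‖castVec v‖ ≤ ρ := by
        rw [hρ]; exact mul_le_mul_of_nonneg_left hRv (by positivity)
      rw [← mul_sub, ← mul_sub, norm_mul, norm_mul, Complex.norm_real, Real.norm_eq_abs, abs_of_nonneg (hd0 v)]
      by_cases hBd' : v ∈ Bd
      · rw [if_pos hBd']
        have hIv0 := IvC_nonneg Δ V a S₀ v
        have hIv := IvC_le hΔ hΔ2 hV hv' a S₀
        have hdiff : ‖(IvC Δ V a S₀ v : ℂ) - ((if castVec v ∈ realCube a S₀ then I₀ else 0 : ℝ) : ℂ)‖ ≤ I₀ := by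
          rw [← Complex.ofReal_sub, Complex.norm_real, Real.norm_eq_abs]
          by_cases hC : castVec v ∈ realCube a S₀
          · rw [if_pos hC, abs_le]; constructor <;> linarith
          · rw [if_neg hC, sub_zero, abs_of_nonneg hIv0]; exact hIv
        calc dWeight X τ m (Ideal.span {coordElt v}) * (‖χ (toQuotMod q (coordElt v))‖ *
              ‖(IvC Δ V a S₀ v : ℂ) - ((if castVec v ∈ realCube a S₀ then I₀ else 0 : ℝ) : ℂ)‖) ≤ 8 * (1 * I₀) :=
            mul_le_mul (hd8 v) (mul_le_mul (hχ v) hdiff (norm_nonneg _) zero_le_one) (by positivity) (by norm_num)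
          _ = 8 * I₀ := by ring
      · rw [if_neg hBd']
        -- then `v̂` is interior or exterior
        have hcase : castVec v ∈ realCube (a.1 + ρ, a.2.1 + ρ, a.2.2 + ρ) (S₀ - 2 * ρ) ∨
            castVec v ∉ realCube (a.1 - ρ, a.2.1 - ρ, a.2.2 - ρ) (S₀ + 2 * ρ) := by
          by_contra h
          push Not at h
          exact hBd' (by rw [hBd, Finset.mem_filter, mem_latticeCube_iff]; exact ⟨h.2, h.1⟩)
        have hzero : (IvC Δ V a S₀ v : ℂ) - ((if castVec v ∈ realCube a S₀ then I₀ else 0 : ℝ) : ℂ) = 0 := by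
          rcases hcase with hin | hout
          · have hvC : castVec v ∈ realCube a S₀ := mem_realCube_of_mem_inner hin (x := castVec v) (by
              rw [sub_self, norm_zero]; rw [hρ]; positivity)
            have hNv : c₄ * V ≤ normForm (castVec v) := by have := (hcube _ hvC).2.2.2; rw [normForm]; exact this
            rw [if_pos hvC, IvC_eq_of_interior h95 hc₄ hV hΔ hΔ16 hΔc hv'.1 hNv
              (fun x hx => mem_realCube_of_mem_inner hin (hx.trans hρv)), sub_self]
          · have hvC : castVec v ∉ realCube a S₀ := not_mem_realCube_of_not_mem_outer hout (x := castVec v) (by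
              rw [sub_self, norm_zero]; rw [hρ]; positivity)
            rw [if_neg hvC, IvC_eq_zero_of_exterior h95 hC₀.le hc₄ hV hΔ hΔ16 hΔc hcube hv'.1
              (fun x hx => not_mem_realCube_of_not_mem_outer hout (hx.trans hρv)), Complex.ofReal_zero, sub_self]
        rw [hzero, norm_zero, mul_zero, mul_zero]
    calc ‖∑ v ∈ L, ((dWeight X τ m (Ideal.span {coordElt v}) : ℂ) * (χ (toQuotMod q (coordElt v)) * IvC Δ V a S₀ v) -
          (dWeight X τ m (Ideal.span {coordElt v}) : ℂ) * (χ (toQuotMod q (coordElt v)) * (if castVec v ∈ realCube a S₀ then I₀ else 0 : ℝ)))‖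
        ≤ ∑ v ∈ L, (if v ∈ Bd then 8 * I₀ else 0) := (norm_sum_le _ _).trans (Finset.sum_le_sum hterm)
      _ = ∑ v ∈ L.filter (fun v => v ∈ Bd), 8 * I₀ := (Finset.sum_filter (fun v => v ∈ Bd) (fun _ => 8 * I₀)).symm
      _ ≤ ∑ v ∈ Bd, 8 * I₀ :=
          Finset.sum_le_sum_of_subset_of_nonneg (fun v hv => (Finset.mem_filter.mp hv).2) fun _ _ _ => mul_nonneg (by norm_num) hI₀0
      _ = I₀ * (8 * Bd.card) := by rw [Finset.sum_const, nsmul_eq_mul]; ring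
  calc ‖∑ v ∈ L, (dWeight X τ m (Ideal.span {coordElt v}) : ℂ) * Jv χ Δ V a S₀ v - (I₀ : ℂ) * Tchi χ X τ m a S₀‖
      ≤ ‖∑ v ∈ L, (dWeight X τ m (Ideal.span {coordElt v}) : ℂ) * Jv χ Δ V a S₀ v -
          ∑ v ∈ L, (dWeight X τ m (Ideal.span {coordElt v}) : ℂ) * (χ (toQuotMod q (coordElt v)) * IvC Δ V a S₀ v)‖ +
        ‖∑ v ∈ L, (dWeight X τ m (Ideal.span {coordElt v}) : ℂ) * (χ (toQuotMod q (coordElt v)) * IvC Δ V a S₀ v) -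
          (I₀ : ℂ) * Tchi χ X τ m a S₀‖ := norm_sub_le_norm_sub_add_norm_sub _ _ _
    _ ≤ I₀ * (16 * Real.pi * Δ * L.card) + I₀ * (8 * Bd.card) := add_le_add h1 h2
    _ = I₀ * (16 * Real.pi * Δ * L.card + 8 * Bd.card) := by ring

end Literature.NumberTheory.Sieve.CubicSieve
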